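import Mathlib
import Summits.ResolutionOfSingularities.ResolutionOfSingularities.Theorems.WeightedInvariantLocalWeightedDropTOT2E1Step
import Summits.ResolutionOfSingularities.ResolutionOfSingularities.Theorems.WeightedInvariantLocalWeightedDropNCResSettingAdmissible
import Summits.ResolutionOfSingularities.ResolutionOfSingularities.Theorems.WeightedInvariantLocalWeightedDropNCResSettingNear
import Summits.ResolutionOfSingularities.ResolutionOfSingularities.Theorems.WeightedInvariantLocalWeightedDropNCResSettingPermissible
import Summits.ResolutionOfSingularities.ResolutionOfSingularities.Theorems.WeightedInvariantLocalWeightedDropNCGameDecoratedWins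

/-!
# `LocalWeightedDrop`, TOT2-LINE piece S-E1, DECORATED: from an `e = 1` state with a prepared axis presentation the decorated strategy
# forces a HEAD DROP (CJS Thm 5.35 / §9 in the count game with boundary and history)

Route `ResolutionOfSingularities/WeightedInvariant`, engine crux `LocalWeightedDrop` (stmt-ResolutionOfSingularities-8899), chain w43
[OURS · L1 W4.3 · TOT2-LINE v1.1 §(E) S-E1 (res-L1-w43-lead-1 g4); decorated half = res-type-056, on res-L1-w43-stub-1's S-SET
(`TameFourTupleDrop.Decoration`, `Admissible`, `transform`, …), res-L1-w43-lead-1's `DWinsTo` calculus, res-L1-w43-stub-4's core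
(`…AxisNearDescent*`) and res-L1-w43-stub-3's near points (`…TOT2Near`)].  Nothing here is a statement of any manuscript.  No definitions.

THE STATEMENT (`dWinsTo_headDrop_of_presentation`).  Decorated states are pairs `(b, δ)` (position, decoration), `germ := Prod.fst`.  Let
`(b, δ)` be admissible with `2 ≤ o` and let the `I₃`-PRODUCT `g := f · ∏_{l ∈ O} x_l` (order `c = o + |O|`, v1.1 (B)) have a PREPARED AXIS
PRESENTATION with a failing integer level (`θ^* g = u · P`, `P` a prepared axis germ, `¬ AboveLevel c r 1 P`).  Then the mover forces, by
count-game moves read on the positions, an admissibly decorated state whose HEAD `(o, c)` is lexicographically SMALLER: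
`DWinsTo Prod.fst (fun τ => Admissible τ.1 τ.2 ∧ τ.2.head < δ.head) (b, δ)`.
THE STRATEGY is the identity point blow-up at every step (`isBPermissible_point_X`: B-permissible for every decoration), the successor decorated by
`Decoration.transform`; THE MEASURE is `0` on states whose product has an apex-free degree-`c` form and `(least failing level) + 1` otherwise;
THE STEP is `TOT2E1.axisStep` once the near successor's product is identified with the sliced strict transform of the product
(`totalO_transform_eq_slice`: at an answer where the head did not drop, every old letter passes through the new point and the new product is the
slice of the old product's strict transform), and `TOT2Near.order_slice_lt_of_apexTrivial` from apex-free states.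
Entry (`dWinsTo_headDrop_of_isolated`): one-dimensional apex of `in_c g` + isolation (`¬ InAxisIdeal c (Φ^* g)` for every legal `Φ`) give the
presentation (`TOT2E1.exists_prepared_presentation`).
-/

set_option linter.dupNamespace false -- mandated namespace of this single-conjunct summit

noncomputable section

namespace Summit.ResolutionOfSingularities.ResolutionOfSingularities.Theorems

open Literature.AlgebraicGeometry.Resolution

namespace TOT2E1

open MvPowerSeries AxisPolyhedron TameFourTupleDrop

variable {k : Type} [Field k] {m : ℕ}

/-! ### Small algebra of the identity point blow-up -/

/-- The chart component for all weights `1`: `x_l ↦ s (c_l + y_l)`. -/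
theorem chart_one_apply (c : Fin (m + 1) → k) (l : Fin (m + 1)) :
    CobordantChart.chart (fun _ : Fin (m + 1) => 1) c l = X 0 * (C (c l) + X l.succ) := by
  rw [CobordantChart.chart_apply, pow_one]

/-- The chart image of a product of letters. -/
theorem prod_chart_one (c : Fin (m + 1) → k) (S : Finset (Fin (m + 1))) :
    ∏ l ∈ S, CobordantChart.chart (fun _ : Fin (m + 1) => 1) c l = X 0 ^ S.card * ∏ l ∈ S, (C (c l) + X l.succ) := by
  simp_rw [chart_one_apply]
  rw [Finset.prod_mul_distrib, Finset.prod_const]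

/-- The slice is multiplicative over finite products. -/
theorem slice_finset_prod {ι : Type} (i : Fin (m + 1)) (s : Finset ι) (f : ι → MvPowerSeries (Fin (m + 1 + 1)) k) :
    TupleGame.slice i (∏ x ∈ s, f x) = ∏ x ∈ s, TupleGame.slice i (f x) := by
  unfold TupleGame.slice
  rw [← coe_substAlgHom (CobordantChartPlaneSlice.hasSubst_slice (R := k) i), map_prod]

/-- The slice of `c_l + y_l`. -/
theorem slice_C_add_X_succ (i l : Fin (m + 1)) (r : k) :
    TupleGame.slice i (C r + X l.succ) = C r + if l = i then (0 : MvPowerSeries (Fin (m + 1)) k) else X (Fin.predAbove i l.succ) := by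
  have hs := CobordantChartPlaneSlice.hasSubst_slice (R := k) i
  unfold TupleGame.slice
  rw [← coe_substAlgHom hs, map_add, coe_substAlgHom, subst_C, subst_X hs]
  by_cases hl : l = i
  · rw [if_pos (by rw [hl]), if_pos hl]
  · rw [if_neg (fun h => hl (Fin.succ_injective _ h)), if_neg hl]

/-- The identity family straightens every letter to itself. -/
theorem strIdx_X (l : Fin (m + 1)) : strIdx (fun j => (X j : MvPowerSeries (Fin (m + 1)) k)) l = l := by
  have h : ∃ (l' : Fin (m + 1)) (u : MvPowerSeries (Fin (m + 1)) k), constantCoeff u ≠ 0 ∧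
      (fun j => (X j : MvPowerSeries (Fin (m + 1)) k)) l = u * X l' :=
    ⟨l, 1, by rw [map_one]; exact one_ne_zero, by rw [one_mul]⟩
  obtain ⟨u, hu, he⟩ := strIdx_spec h
  symm
  refine eq_of_X_dvd_X (k := k) ?_
  -- `x_l = u · x_{l'}` with `u` a unit, so `x_l ∣ x_{l'}`
  have hunit : IsUnit u := by
    rw [MvPowerSeries.isUnit_iff_constantCoeff]
    exact Ne.isUnit hu
  obtain ⟨v, hv⟩ := hunit
  refine ⟨↑v⁻¹, ?_⟩
  have he' : (X l : MvPowerSeries (Fin (m + 1)) k) = u * X (strIdx (fun j => (X j : MvPowerSeries (Fin (m + 1)) k)) l) := he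
  rw [he', ← hv, mul_comm, ← mul_assoc, Units.inv_mul, one_mul]

/-- The identity substitution family is the identity. -/
theorem subst_X_fun {n : ℕ} (f : MvPowerSeries (Fin n) k) : subst (fun j => (X j : MvPowerSeries (Fin n) k)) f = f := by
  change subst X f = f
  rw [subst_self]
  rfl

/-! ### The product `g = f · ∏_{l ∈ O} x_l` under the identity point blow-up -/

section Product

variable {b : MvPowerSeries (Fin (m + 1)) k} {δ : Decoration k m} {c : Fin (m + 1) → k} {i : Fin (m + 1)}

/-- The chart transform of `f` under the identity point move: `f(s(c+y)) = s^o · G_f`, `G_f = satPart`. -/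
theorem chart_f_eq (hadm : Admissible b δ) (c : Fin (m + 1) → k) :
    subst (CobordantChart.chart (fun _ : Fin (m + 1) => 1) c) δ.f =
      X 0 ^ δ.o * satPart (δ.fChart (fun j => (X j : MvPowerSeries (Fin (m + 1)) k)) (fun _ => 1) c) := by
  have hf : δ.f ≠ 0 := hadm.2.1.ne_zero
  have hperm := isBPermissible_point_X (k := k) δ
  have hc : ∀ l : Fin (m + 1), (fun _ : Fin (m + 1) => (1 : ℕ)) l = 0 → c l = 0 := fun l hl => absurd hl one_ne_zero
  obtain ⟨hfac, -⟩ := Decoration.fChart_eq (δ := δ) (c := c) hperm.1 hc hf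
  have hA := Decoration.satExp_fChart_eq_order (c := c) hperm hc hf
  have hfin : δ.f.order ≠ ⊤ := by rw [ne_eq, order_eq_top_iff]; exact hf
  have hAo : satExp (δ.fChart (fun j => (X j : MvPowerSeries (Fin (m + 1)) k)) (fun _ => 1) c) = δ.o := by
    have h : ((satExp (δ.fChart (fun j => (X j : MvPowerSeries (Fin (m + 1)) k)) (fun _ => 1) c) : ℕ) : ℕ∞) =
        ((δ.o : ℕ) : ℕ∞) := by rw [hA, Decoration.o, ENat.coe_toNat hfin]
    exact_mod_cast h
  rw [subst_X_fun, hAo] at hfac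
  exact hfac

/-- **THE CHART TRANSFORM OF THE PRODUCT**: `g(s(c+y)) = s^c · (G_f · ∏_{l ∈ O} (c_l + y_l))`. -/
theorem chart_totalO_eq (hadm : Admissible b δ) (c : Fin (m + 1) → k) :
    subst (CobordantChart.chart (fun _ : Fin (m + 1) => 1) c) (δ.f * ∏ l ∈ δ.O, X l) =
      X 0 ^ δ.c * (satPart (δ.fChart (fun j => (X j : MvPowerSeries (Fin (m + 1)) k)) (fun _ => 1) c) *
        ∏ l ∈ δ.O, (C (c l) + X l.succ)) := by
  have hc : ∀ l : Fin (m + 1), (fun _ : Fin (m + 1) => (1 : ℕ)) l = 0 → c l = 0 := fun l hl => absurd hl one_ne_zero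
  have hch := CobordantChart.hasSubst_chart (fun _ : Fin (m + 1) => 1) c hc
  rw [← coe_substAlgHom hch, map_mul, map_prod, coe_substAlgHom, chart_f_eq hadm c]
  simp only [subst_X hch]
  rw [prod_chart_one, Decoration.c, pow_add]
  ring

/-- The slice of `G_f · ∏ (c_l + y_l)`. -/
theorem slice_totalO_eq (δ : Decoration k m) (c : Fin (m + 1) → k) (i : Fin (m + 1)) (Gf : MvPowerSeries (Fin (m + 1 + 1)) k) :
    TupleGame.slice i (Gf * ∏ l ∈ δ.O, (C (c l) + X l.succ)) =
      TupleGame.slice i Gf * ∏ l ∈ δ.O, (C (c l) + if l = i then (0 : MvPowerSeries (Fin (m + 1)) k) else X (Fin.predAbove i l.succ)) := by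
  rw [slice_mul, slice_finset_prod]
  simp_rw [slice_C_add_X_succ]

/-- **AT A NEAR ANSWER THE NEW PRODUCT IS THE SLICE OF THE OLD PRODUCT'S STRICT TRANSFORM.**  Under the identity point move, at an answer
`(c, i)` where the head `(o, c)` of the transform did not drop: every old letter passes through the new point (`c_l = 0` for `l ∈ O`), the new
equation is the sliced strict transform, and `f' · ∏_{l ∈ O'} x_l = (G_f · ∏_{l∈O} (c_l + y_l))|_{y_i = 0}`. -/
theorem totalO_transform_eq_slice (hadm : Admissible b δ) (hci : c i ≠ 0)
    (hhead : (δ.transform (fun j => (X j : MvPowerSeries (Fin (m + 1)) k)) (fun _ => 1) c i).head = δ.head) :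
    (δ.transform (fun j => (X j : MvPowerSeries (Fin (m + 1)) k)) (fun _ => 1) c i).f *
        ∏ l ∈ (δ.transform (fun j => (X j : MvPowerSeries (Fin (m + 1)) k)) (fun _ => 1) c i).O, X l =
      TupleGame.slice i (satPart (δ.fChart (fun j => (X j : MvPowerSeries (Fin (m + 1)) k)) (fun _ => 1) c) *
        ∏ l ∈ δ.O, (C (c l) + X l.succ)) := by
  classical
  set Φ : Fin (m + 1) → MvPowerSeries (Fin (m + 1)) k := fun j => X j with hΦ
  have hf : δ.f ≠ 0 := hadm.2.1.ne_zero
  have hperm : IsBPermissible δ Φ (fun _ => 1) := isBPermissible_point_X (k := k) δ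
  have hc : ∀ l : Fin (m + 1), (fun _ : Fin (m + 1) => (1 : ℕ)) l = 0 → c l = 0 := fun l hl => absurd hl one_ne_zero
  -- head equal: `o' = o` and `|O'| = |O|`
  have hoc : (δ.transform Φ (fun _ => 1) c i).o = δ.o ∧ (δ.transform Φ (fun _ => 1) c i).O.card = δ.O.card := by
    rw [Decoration.head, Decoration.head, toLex_inj, Prod.mk.injEq, Decoration.c, Decoration.c] at hhead
    exact ⟨hhead.1, by omega⟩
  obtain ⟨ho, hcard⟩ := hoc
  have hnot : ¬ ((sqfRep (δ.strict Φ (fun _ => 1) c i)).order).toNat < δ.o := by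
    rw [← Decoration.transform_o]; omega
  -- all old letters pass through the new point
  have hO' : (δ.transform Φ (fun _ => 1) c i).O = Decoration.newLetters δ.O Φ c i := Decoration.transform_O_of_not_lt _ _ _ _ _ hnot
  have hthrough : ∀ l ∈ δ.O, c l = 0 := by
    have h1 : (δ.O.filter fun l => c (strIdx Φ l) = 0).card = δ.O.card := by
      refine le_antisymm (Finset.card_filter_le _ _) ?_
      rw [← hcard, hO']
      unfold Decoration.newLetters
      exact Finset.card_image_le
    intro l hl
    have h2 := (Finset.card_filter_eq_iff.mp h1) l hl
    rwa [hΦ, strIdx_X] at h2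
  -- the new product
  rw [Decoration.transform_f_eq_strict_of_o_transform_eq hperm hc hf hci ho, hO', Decoration.prod_X_newLetters hperm c hci δ.O_subset,
    slice_totalO_eq, Finset.filter_true_of_mem (fun l hl => by rw [hΦ, strIdx_X]; exact hthrough l hl)]
  unfold Decoration.strict
  congr 1
  refine Finset.prod_congr rfl fun l hl => ?_
  have hli : l ≠ i := fun h => hci (h ▸ hthrough l hl)
  rw [hΦ, strIdx_X, hthrough l hl, map_zero, zero_add, if_neg hli]

/-- At a near answer the new product has order `c` (the new head is the old one and the transform is admissible). -/
theorem order_totalO_transform (hadm : Admissible b δ) {A : ℕ} {G : MvPowerSeries (Fin (m + 1 + 1)) k}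
    (hfac : subst (CobordantChart.chart (fun _ : Fin (m + 1) => 1) c) (subst (fun j => (X j : MvPowerSeries (Fin (m + 1)) k)) b) =
      X 0 ^ A * G) (hG : ¬ X 0 ∣ G) (hci : c i ≠ 0)
    (hhead : (δ.transform (fun j => (X j : MvPowerSeries (Fin (m + 1)) k)) (fun _ => 1) c i).head = δ.head) :
    ((δ.transform (fun j => (X j : MvPowerSeries (Fin (m + 1)) k)) (fun _ => 1) c i).f *
        ∏ l ∈ (δ.transform (fun j => (X j : MvPowerSeries (Fin (m + 1)) k)) (fun _ => 1) c i).O, X l).order = (δ.c : ℕ∞) := by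
  have hc : ∀ l : Fin (m + 1), (fun _ : Fin (m + 1) => (1 : ℕ)) l = 0 → c l = 0 := fun l hl => absurd hl one_ne_zero
  have hadm' := admissible_transform hadm (isBPermissible_point_X (k := k) δ) hc hfac hG hci
  rw [Decoration.order_totalO hadm']
  have h : (δ.transform (fun j => (X j : MvPowerSeries (Fin (m + 1)) k)) (fun _ => 1) c i).c = δ.c := by
    rw [Decoration.head, Decoration.head, toLex_inj, Prod.mk.injEq] at hhead
    exact hhead.2
  rw [h]

end Product

/-! ### A presentation exhibits a non-zero invariance vector -/

/-- A germ with a prepared axis presentation is NOT apex-free: `L e_z` (`L` the linear part of `θ`) is a non-zero translation-invariance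
vector of its degree-`d` form (the form of `P` does not see `z`). -/
theorem exists_invariance_of_presentation (g : MvPowerSeries (Fin (m + 1)) k) {d : ℕ} (hgd : g.order = d)
    (θ : Fin (m + 1) → MvPowerSeries (Fin (m + 1)) k) (hθ0 : ∀ l, constantCoeff (θ l) = 0)
    (hθdet : IsUnit (Matrix.det (Matrix.of fun a j : Fin (m + 1) => coeff (Finsupp.single j 1) (θ a))))
    (u P : MvPowerSeries (Fin (m + 1)) k) (hu : constantCoeff u ≠ 0) (hgP : subst θ g = u * P) (hcone : AxisCone d P) :
    ∃ v : Fin (m + 1) → k, v ≠ 0 ∧ ∀ x, CobordantChart.initEval (fun _ : Fin (m + 1) => 1) (x + v) d g =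
      CobordantChart.initEval (fun _ : Fin (m + 1) => 1) x d g := by
  set L : Matrix (Fin (m + 1)) (Fin (m + 1)) k := Matrix.of fun a j : Fin (m + 1) => coeff (Finsupp.single j 1) (θ a) with hL
  have hdet : IsUnit L.det := hθdet
  have hPd : P.order = d := by
    rw [← order_unit_mul u P hu, ← hgP, order_subst_eq_of_legal θ hθ0 hθdet g, hgd]
  set ez : Fin (m + 1) → k := Pi.single (Fin.last m) 1 with hez
  refine ⟨L.mulVec ez, fun h => ?_, fun y => ?_⟩
  · have h0 : ez = 0 := AxisNormalize.eq_zero_of_mulVec_eq_zero hdet h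
    have h1 := congrFun h0 (Fin.last m)
    rw [hez, Pi.single_eq_same, Pi.zero_apply] at h1
    exact one_ne_zero h1
  · -- read `in_d g` at `L x` through `θ`: `in_d g (L x) = u(0) · in_d P (x)`
    have hread : ∀ x, CobordantChart.initEval (fun _ : Fin (m + 1) => 1) (L.mulVec x) d g =
        constantCoeff u * CobordantChart.initEval (fun _ : Fin (m + 1) => 1) x d P := by
      intro x
      rw [← initEval_subst_legal θ hθ0 hθdet g hgd, hgP, initEval_unit_mul u P hPd.symm.le]
    have hP : ∀ x, CobordantChart.initEval (fun _ : Fin (m + 1) => 1) (x + ez) d P =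
        CobordantChart.initEval (fun _ : Fin (m + 1) => 1) x d P := fun x =>
      AxisPointMove.initEval_eq_of_axisCone hcone fun j => by
        rw [Pi.add_apply, hez, Pi.single_eq_of_ne (Fin.castSucc_lt_last j).ne, add_zero]
    rw [← AxisNormalize.mulVec_nonsing_inv_mulVec hdet y, ← Matrix.mulVec_add, hread, hread, hP]

/-! ### The decorated regime theorem -/

/-- **S-E1, DECORATED: FROM A STATE WHOSE PRODUCT `g = f · ∏_{l∈O} x_l` HAS A PREPARED AXIS PRESENTATION THE MOVER FORCES A HEAD DROP.**
See the module docstring.  States: `(position, decoration)`, `germ := Prod.fst`; hypotheses: admissible, `2 ≤ o`, a prepared axis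
presentation of the product at `d = c` with a failing integer level; conclusion: `DWinsTo` towards «admissibly decorated with smaller head». -/
theorem dWinsTo_headDrop_of_presentation [Infinite k] {b : MvPowerSeries (Fin (m + 1)) k} {δ : Decoration k m}
    (hadm : Admissible b δ) (ho : 2 ≤ δ.o)
    (hpres : ∃ (θ : Fin (m + 1) → MvPowerSeries (Fin (m + 1)) k) (u P : MvPowerSeries (Fin (m + 1)) k) (r : ℕ),
      (∀ l, constantCoeff (θ l) = 0) ∧ IsUnit (Matrix.det (Matrix.of fun a j : Fin (m + 1) => coeff (Finsupp.single j 1) (θ a))) ∧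
      constantCoeff u ≠ 0 ∧ subst θ (δ.f * ∏ l ∈ δ.O, X l) = u * P ∧
      AxisCone δ.c P ∧ TrivialApexX δ.c P ∧ PreparedAxis δ.c P ∧ ¬ AboveLevel δ.c r 1 P) :
    DWinsTo (St := MvPowerSeries (Fin (m + 1)) k × Decoration k m) Prod.fst
      (fun τ => Admissible τ.1 τ.2 ∧ τ.2.head < δ.head) (b, δ) := by
  classical
  -- the two kinds of states of the regime: «has a presentation with failing level r» and «apex-free»
  set Pres : (MvPowerSeries (Fin (m + 1)) k × Decoration k m) → ℕ → Prop := fun τ r =>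
    ∃ (θ : Fin (m + 1) → MvPowerSeries (Fin (m + 1)) k) (u P : MvPowerSeries (Fin (m + 1)) k),
      (∀ l, constantCoeff (θ l) = 0) ∧ IsUnit (Matrix.det (Matrix.of fun a j : Fin (m + 1) => coeff (Finsupp.single j 1) (θ a))) ∧
      constantCoeff u ≠ 0 ∧ subst θ (τ.2.f * ∏ l ∈ τ.2.O, X l) = u * P ∧
      AxisCone τ.2.c P ∧ TrivialApexX τ.2.c P ∧ PreparedAxis τ.2.c P ∧ ¬ AboveLevel τ.2.c r 1 P with hPres
  set AF : (MvPowerSeries (Fin (m + 1)) k × Decoration k m) → Prop := fun τ =>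
    ∀ v : Fin (m + 1) → k, (∀ x, CobordantChart.initEval (fun _ : Fin (m + 1) => 1) (x + v) τ.2.c (τ.2.f * ∏ l ∈ τ.2.O, X l) =
      CobordantChart.initEval (fun _ : Fin (m + 1) => 1) x τ.2.c (τ.2.f * ∏ l ∈ τ.2.O, X l)) → v = 0 with hAF
  set Cl : Set (MvPowerSeries (Fin (m + 1)) k × Decoration k m) :=
    {τ | Admissible τ.1 τ.2 ∧ τ.2.head = δ.head ∧ ((∃ r, Pres τ r) ∨ AF τ)} with hCl
  set μ : (MvPowerSeries (Fin (m + 1)) k × Decoration k m) → Ordinal.{0} := fun τ =>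
    ((sInf {N : ℕ | (AF τ ∧ N = 0) ∨ ∃ r, Pres τ r ∧ N = r + 1} : ℕ) : Ordinal.{0}) with hμ
  -- measure bookkeeping
  have hμ_le_AF : ∀ τ, AF τ → μ τ = 0 := by
    intro τ h
    have hmem : (0 : ℕ) ∈ {N : ℕ | (AF τ ∧ N = 0) ∨ ∃ r, Pres τ r ∧ N = r + 1} := Or.inl ⟨h, rfl⟩
    have h0 : sInf {N : ℕ | (AF τ ∧ N = 0) ∨ ∃ r, Pres τ r ∧ N = r + 1} = 0 := Nat.eq_zero_of_le_zero (Nat.sInf_le hmem)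
    simp only [hμ, h0, Nat.cast_zero]
  have hμ_le_Pres : ∀ τ r, Pres τ r → μ τ ≤ ((r + 1 : ℕ) : Ordinal.{0}) := by
    intro τ r h
    have hmem : r + 1 ∈ {N : ℕ | (AF τ ∧ N = 0) ∨ ∃ r, Pres τ r ∧ N = r + 1} := Or.inr ⟨r, h, rfl⟩
    exact Nat.cast_le.mpr (Nat.sInf_le hmem)
  have hμ_eq : ∀ τ, ¬ AF τ → (∃ r, Pres τ r) → ∃ r, Pres τ r ∧ μ τ = ((r + 1 : ℕ) : Ordinal.{0}) := by
    intro τ hnaf ⟨r₀, h₀⟩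
    have hne : ({N : ℕ | (AF τ ∧ N = 0) ∨ ∃ r, Pres τ r ∧ N = r + 1} : Set ℕ).Nonempty := ⟨r₀ + 1, Or.inr ⟨r₀, h₀, rfl⟩⟩
    rcases Nat.sInf_mem hne with ⟨haf, -⟩ | ⟨r, hr, hN⟩
    · exact absurd haf hnaf
    · exact ⟨r, hr, by simp only [hμ, hN]⟩
  obtain ⟨θ₀, u₀, P₀, r₀', hpres'⟩ := hpres
  refine DWinsTo.of_measure Cl μ ?_ ⟨hadm, rfl, Or.inl ⟨r₀', θ₀, u₀, P₀, hpres'⟩⟩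
  -- THE STEP: from `τ ∈ Cl`, play the identity point blow-up
  rintro ⟨bτ, δτ⟩ ⟨hadmτ, hheadτ, hcase⟩ -
  dsimp only at hadmτ hheadτ
  have hf : δτ.f ≠ 0 := hadmτ.2.1.ne_zero
  have hoτ : δτ.o = δ.o := by
    have h := hheadτ
    rw [Decoration.head, Decoration.head, toLex_inj, Prod.mk.injEq] at h
    exact h.1
  have hd : 1 ≤ δτ.c := by rw [Decoration.c]; omega
  have hperm := isBPermissible_point_X (k := k) δτ
  have hconv : ∀ (cc : Fin (m + 1) → k) (l : Fin (m + 1)), (fun _ : Fin (m + 1) => (1 : ℕ)) l = 0 → cc l = 0 :=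
    fun cc l hl => absurd hl one_ne_zero
  refine ⟨fun j => X j, fun _ => 1, hperm.1, ?_⟩
  intro c _ hc0 A G hfac hG
  obtain ⟨i, hci⟩ : ∃ i, c i ≠ 0 := Function.ne_iff.mp hc0
  set δ' := δτ.transform (fun j => (X j : MvPowerSeries (Fin (m + 1)) k)) (fun _ => 1) c i with hδ'
  have hadm' : Admissible (X 0 * TupleGame.slice i G) δ' := admissible_transform hadmτ hperm (hconv c) hfac hG hci
  have hhead' : δ'.head ≤ δτ.head := Decoration.head_transform_le hperm (hconv c) hf hci
  refine ⟨i, hci, (X 0 * TupleGame.slice i G, δ'), rfl, ?_⟩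
  by_cases hlt : δ'.head < δτ.head
  · exact Or.inl ⟨hadm', by rw [← hheadτ]; exact hlt⟩
  right
  have heq : δ'.head = δτ.head := le_antisymm hhead' (not_lt.mp hlt)
  -- at a near answer: the new product is the slice of the old product's strict transform, of order `d = c`
  set g : MvPowerSeries (Fin (m + 1)) k := δτ.f * ∏ l ∈ δτ.O, X l with hg
  set Gg : MvPowerSeries (Fin (m + 1 + 1)) k := satPart (δτ.fChart (fun j => (X j : MvPowerSeries (Fin (m + 1)) k)) (fun _ => 1) c) *
    ∏ l ∈ δτ.O, (C (c l) + X l.succ) with hGg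
  have hgd : g.order = δτ.c := Decoration.order_totalO hadmτ
  have hfacg : subst (CobordantChart.chart (fun _ : Fin (m + 1) => 1) c) g = X 0 ^ δτ.c * Gg := chart_totalO_eq hadmτ c
  have hid : δ'.f * ∏ l ∈ δ'.O, X l = TupleGame.slice i Gg := totalO_transform_eq_slice hadmτ hci heq
  have hc' : δ'.c = δτ.c := by
    have h := heq
    rw [Decoration.head, Decoration.head, toLex_inj, Prod.mk.injEq] at h
    exact h.2
  have hordd : (TupleGame.slice i Gg).order = δτ.c := by
    rw [← hid]
    exact order_totalO_transform hadmτ hfac hG hci heq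
  rcases hcase with ⟨r₀, hP₀⟩ | hAFτ
  swap
  · -- an apex-free state has no near answer at all
    exfalso
    have hlt' := TOT2Near.order_slice_lt_of_apexTrivial g hAFτ c i hci hfacg
    rw [hordd] at hlt'
    exact lt_irrefl _ hlt'
  · -- a state with a presentation: the axis step theorem
    have hinv : ∀ r, Pres (bτ, δτ) r → ¬ AF (bτ, δτ) := by
      rintro r ⟨θ, u, P, hθ0, hθdet, hu, hgP, hcone, -, -, -⟩ haf
      obtain ⟨v, hv, hvinv⟩ := exists_invariance_of_presentation g hgd θ hθ0 hθdet u P hu hgP hcone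
      exact hv (haf v hvinv)
    obtain ⟨r, hPr, hμτ⟩ := hμ_eq (bτ, δτ) (hinv r₀ hP₀) ⟨r₀, hP₀⟩
    obtain ⟨θ, u, P, hθ0, hθdet, hu, hgP, hcone, hapex, hprep, hr⟩ := hPr
    rcases axisStep g hd hgd θ hθ0 hθdet u P hu hgP hcone hapex hprep hr hci hfacg with
      hA | ⟨-, θ', u', P', hθ'0, hθ'det, hu', hgP', hcone', hapex', hprep', hr', h3⟩ | ⟨-, hAF'⟩
    · exfalso
      rw [hordd] at hA
      exact lt_irrefl _ hA
    · -- again a presentation, one level lower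
      have hPres' : Pres (X 0 * TupleGame.slice i G, δ') (r - 1) := by
        refine ⟨θ', u', P', hθ'0, hθ'det, hu', ?_, ?_, ?_, ?_, ?_⟩
        · rw [hid]; exact hgP'
        · rw [hc']; exact hcone'
        · rw [hc']; exact hapex'
        · rw [hc']; exact hprep'
        · rw [hc']; exact hr'
      refine ⟨⟨hadm', heq.trans hheadτ, Or.inl ⟨r - 1, hPres'⟩⟩, ?_⟩
      calc μ (X 0 * TupleGame.slice i G, δ') ≤ ((r - 1 + 1 : ℕ) : Ordinal.{0}) := hμ_le_Pres _ _ hPres'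
        _ < ((r + 1 : ℕ) : Ordinal.{0}) := Nat.cast_lt.mpr (by omega)
        _ = μ (bτ, δτ) := hμτ.symm
    · -- the successor is apex-free
      have hAF' : AF (X 0 * TupleGame.slice i G, δ') := by
        intro v hv
        refine hAF' v fun x => ?_
        have h := hv x
        rwa [hid, hc'] at h
      refine ⟨⟨hadm', heq.trans hheadτ, Or.inr hAF'⟩, ?_⟩
      rw [hμ_le_AF _ hAF', hμτ]
      exact Nat.cast_lt.mpr (Nat.succ_pos r)

/-- **S-E1, DECORATED, WITH THE GEOMETRIC ENTRY HYPOTHESES**: admissible, `2 ≤ o`, the degree-`c` form of the product `g = f · ∏_{l∈O} x_l`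
has a ONE-DIMENSIONAL APEX (`hone`/`hcol`, the shapes of `AxisCut.axisStartsWon`: `e^O = 1`), and the point is ISOLATED in its
`(o, c)`-stratum in the strong form «no formal coordinate change makes `g` equimultiple along the axis» (no B-permissible curve centre in any
coordinates).  Then the mover forces an admissibly decorated state with smaller head. -/
theorem dWinsTo_headDrop_of_isolated [Infinite k] {b : MvPowerSeries (Fin (m + 1)) k} {δ : Decoration k m}
    (hadm : Admissible b δ) (ho : 2 ≤ δ.o)
    (hone : ∃ v : Fin (m + 1) → k, v ≠ 0 ∧ ∀ x : Fin (m + 1) → k,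
      CobordantChart.initEval (fun _ : Fin (m + 1) => 1) (x + v) δ.c (δ.f * ∏ l ∈ δ.O, X l) =
        CobordantChart.initEval (fun _ : Fin (m + 1) => 1) x δ.c (δ.f * ∏ l ∈ δ.O, X l))
    (hcol : ∀ v₁ v₂ : Fin (m + 1) → k,
      (∀ x : Fin (m + 1) → k, CobordantChart.initEval (fun _ : Fin (m + 1) => 1) (x + v₁) δ.c (δ.f * ∏ l ∈ δ.O, X l) =
        CobordantChart.initEval (fun _ : Fin (m + 1) => 1) x δ.c (δ.f * ∏ l ∈ δ.O, X l)) →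
      (∀ x : Fin (m + 1) → k, CobordantChart.initEval (fun _ : Fin (m + 1) => 1) (x + v₂) δ.c (δ.f * ∏ l ∈ δ.O, X l) =
        CobordantChart.initEval (fun _ : Fin (m + 1) => 1) x δ.c (δ.f * ∏ l ∈ δ.O, X l)) →
      ∃ α β : k, (α ≠ 0 ∨ β ≠ 0) ∧ α • v₁ + β • v₂ = 0)
    (hisol : ∀ Φ : Fin (m + 1) → MvPowerSeries (Fin (m + 1)) k, (∀ l, constantCoeff (Φ l) = 0) →
      IsUnit (Matrix.det (Matrix.of fun a j : Fin (m + 1) => coeff (Finsupp.single j 1) (Φ a))) →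
      ¬ InAxisIdeal δ.c (subst Φ (δ.f * ∏ l ∈ δ.O, X l))) :
    DWinsTo (St := MvPowerSeries (Fin (m + 1)) k × Decoration k m) Prod.fst
      (fun τ => Admissible τ.1 τ.2 ∧ τ.2.head < δ.head) (b, δ) := by
  obtain ⟨θ, hθ0, hθdet, -, hcone, hapex, hprep, hfin⟩ :=
    exists_prepared_presentation (δ.f * ∏ l ∈ δ.O, X l) δ.c (Decoration.order_totalO hadm) hone hcol hisol
  obtain ⟨r, hr⟩ := AxisNearDescent.exists_not_aboveLevel_of_not_inAxisIdeal hfin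
  exact dWinsTo_headDrop_of_presentation hadm ho
    ⟨θ, 1, subst θ (δ.f * ∏ l ∈ δ.O, X l), r, hθ0, hθdet, by rw [map_one]; exact one_ne_zero, (one_mul _).symm,
      hcone, hapex, hprep, hr⟩

end TOT2E1

end Summit.ResolutionOfSingularities.ResolutionOfSingularities.Theorems

end
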